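import Mathlib

/-!
# The third transport inequality: the algebraic core (seat mine-b, cell pub-perc-repro2)

Polynomial inequalities over `ℤ` behind `Tail2DThirdInequality.lean`, where `M = #Conf`,
`A = a₁ = #{r ≥ 1}`, `B = a₂ = #{r ≥ 2}`, `C = c = #{r ≥ 1 ∧ b ≥ 1}`, `P = #{r = 0}`, `Q = #{r = 1}`,
`Z = #{r = b = 0}`, `X = #{r ≥ 1 ∧ b = 0}` are the counts of a uniformly two-coloured series–parallel
network. Every inequality is closed by an explicit identity (`ring`) and the positivity of its terms:

* `bk_ser_alg`: the series step of BK′ `4 a₂ M⁴ ≤ a₁² (2M³ + a₁M² + a₁³)` — Chebyshev's sum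
  inequality for the similarly ordered sequences `M³ ≥ a₁M² ≥ a₁³` and `M'³ ≥ a₁'M'² ≥ a₁'³`;
* `bk_par_alg`: the parallel step of BK′ in its dual form `a₁ P (4M³ + 2a₁M² + a₁²M + a₁³) ≤ 4QM⁴`
  (`P = M − a₁`, `Q = a₁ − a₂`), with the two-variable certificate
  `4D·Δ = N·[S(2D − S)(6S² − SD + 2D²) + 3S(D + 2S)(S² − 4ND) + 4N²(D + 4S − N)D]`;
* `third_alg`: Harris `cM ≤ a₁²` and BK′ give `F = 9a₁² − 3a₁a₂ + 2a₂c − 8cM ≥ 0` through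
  `4M⁵F = [BK′-slack](3a₁ − 2c)M + [Harris-slack](32M⁵ − 2a₁²(2M³ + a₁M² + a₁³))
   + a₁²(M − a₁)²(2a₁³ + a₁²M + 2a₁M² + 4M³)`;
* `third_count_alg`: `F ≥ 0` is the six-count form `(2P + 2Z)·2c ≤ (Q + 2X)² + (Q + 2X)·a₂` of the
  third transport inequality, by the count identities `a₁ + P = M`, `Q + a₂ = a₁`, `c + 2P = M + Z`,
  `X + Z = P`.
-/

namespace Summit.Ventures.PercRepro2.Tail2D

/-- Chebyshev's sum inequality for the sequences `M³ ≥ a₁M² ≥ a₁³`, in the form used by the series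
step of BK′: `(2x₀ + x₁ + x₃)(2y₀ + y₁ + y₃) + [2(x₀−x₁)(y₀−y₁) + 2(x₀−x₃)(y₀−y₃) + (x₁−x₃)(y₁−y₃)]
= 4(2x₀y₀ + x₁y₁ + x₃y₃)`. -/
lemma bk_ser_alg (M A B M' A' B' : ℤ) (hA0 : 0 ≤ A) (hAM : A ≤ M) (hA0' : 0 ≤ A') (hAM' : A' ≤ M')
    (hB0' : 0 ≤ B')
    (h : 4 * B * M ^ 4 ≤ A ^ 2 * (2 * M ^ 3 + A * M ^ 2 + A ^ 3))
    (h' : 4 * B' * M' ^ 4 ≤ A' ^ 2 * (2 * M' ^ 3 + A' * M' ^ 2 + A' ^ 3)) :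
    4 * (B * B') * (M * M') ^ 4 ≤ (A * A') ^ 2 * (2 * (M * M') ^ 3 + (A * A') * (M * M') ^ 2 + (A * A') ^ 3) := by
  have hM : 0 ≤ M := le_trans hA0 hAM
  have hM' : 0 ≤ M' := le_trans hA0' hAM'
  have hp : (4 * B * M ^ 4) * (4 * B' * M' ^ 4)
      ≤ (A ^ 2 * (2 * M ^ 3 + A * M ^ 2 + A ^ 3)) * (A' ^ 2 * (2 * M' ^ 3 + A' * M' ^ 2 + A' ^ 3)) :=
    mul_le_mul h h' (by positivity) (by positivity)
  have d1 : 0 ≤ M ^ 3 - A * M ^ 2 := by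
    have : M ^ 3 - A * M ^ 2 = M ^ 2 * (M - A) := by ring
    rw [this]; exact mul_nonneg (by positivity) (sub_nonneg.2 hAM)
  have d1' : 0 ≤ M' ^ 3 - A' * M' ^ 2 := by
    have : M' ^ 3 - A' * M' ^ 2 = M' ^ 2 * (M' - A') := by ring
    rw [this]; exact mul_nonneg (by positivity) (sub_nonneg.2 hAM')
  have d2 : 0 ≤ M ^ 3 - A ^ 3 := sub_nonneg.2 (pow_le_pow_left₀ hA0 hAM 3)
  have d2' : 0 ≤ M' ^ 3 - A' ^ 3 := sub_nonneg.2 (pow_le_pow_left₀ hA0' hAM' 3)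
  have d3 : 0 ≤ A * M ^ 2 - A ^ 3 := by
    have : A * M ^ 2 - A ^ 3 = A * (M ^ 2 - A ^ 2) := by ring
    rw [this]; exact mul_nonneg hA0 (sub_nonneg.2 (pow_le_pow_left₀ hA0 hAM 2))
  have d3' : 0 ≤ A' * M' ^ 2 - A' ^ 3 := by
    have : A' * M' ^ 2 - A' ^ 3 = A' * (M' ^ 2 - A' ^ 2) := by ring
    rw [this]; exact mul_nonneg hA0' (sub_nonneg.2 (pow_le_pow_left₀ hA0' hAM' 2))
  have c4 : 0 ≤ (A * A') ^ 2 := by positivity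
  have c1 := mul_nonneg c4 (mul_nonneg d1 d1')
  have c2 := mul_nonneg c4 (mul_nonneg d2 d2')
  have c3 := mul_nonneg c4 (mul_nonneg d3 d3')
  linarith [c1, c2, c3, hp]

/-- The parallel step of BK′ in its dual form `a₁ P (4M³ + 2a₁M² + a₁²M + a₁³) ≤ 4 Q M⁴`
(`P = M − a₁`): with `P'' = PP'`, `Q'' = QP' + PQ'`, `a₁'' = a₁M' + a₁'M − a₁a₁'`. The certificate:
for `D = MM'`, `N = a₁a₁'`, `S = a₁M' + a₁'M`, `R(x, m) = 4m³ + 2xm² + x²m + x³`,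
`4D · [a₁R(a₁,M)M'⁴ + a₁'R(a₁',M')M⁴ − (S − N)R(S − N, D)]
  = N · [S(2D − S)(6S² − SD + 2D²) + 3S(D + 2S)(S² − 4ND) + 4N²(D + 4S − N)D]`,
where `24(6S² − SD + 2D²) = (12S − D)² + 47D²` and `S² − 4ND = (a₁M' − a₁'M)²`. -/
lemma bk_par_alg (M A Q M' A' Q' : ℤ) (hA0 : 0 ≤ A) (hAM : A ≤ M) (hA0' : 0 ≤ A') (hAM' : A' ≤ M')
    (hM : 0 < M) (hM' : 0 < M')
    (h : A * (M - A) * (4 * M ^ 3 + 2 * A * M ^ 2 + A ^ 2 * M + A ^ 3) ≤ 4 * Q * M ^ 4)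
    (h' : A' * (M' - A') * (4 * M' ^ 3 + 2 * A' * M' ^ 2 + A' ^ 2 * M' + A' ^ 3) ≤ 4 * Q' * M' ^ 4) :
    (A * M' + A' * M - A * A') * ((M - A) * (M' - A'))
        * (4 * (M * M') ^ 3 + 2 * (A * M' + A' * M - A * A') * (M * M') ^ 2
            + (A * M' + A' * M - A * A') ^ 2 * (M * M') + (A * M' + A' * M - A * A') ^ 3)
      ≤ 4 * (Q * (M' - A') + (M - A) * Q') * (M * M') ^ 4 := by
  have hD0 : 0 < M * M' := mul_pos hM hM'
  have hS0 : 0 ≤ A * M' + A' * M := by positivity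
  have hN0 : 0 ≤ A * A' := by positivity
  have hP0 : 0 ≤ M - A := sub_nonneg.2 hAM
  have hP0' : 0 ≤ M' - A' := sub_nonneg.2 hAM'
  have h2DS : 0 ≤ 2 * (M * M') - (A * M' + A' * M) := by
    have : 2 * (M * M') - (A * M' + A' * M) = M' * (M - A) + M * (M' - A') := by ring
    rw [this]; exact add_nonneg (mul_nonneg hM'.le hP0) (mul_nonneg hM.le hP0')
  have hquad : 0 ≤ 6 * (A * M' + A' * M) ^ 2 - (A * M' + A' * M) * (M * M') + 2 * (M * M') ^ 2 := by
    nlinarith [sq_nonneg (12 * (A * M' + A' * M) - M * M'), sq_nonneg (M * M')]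
  have hsq : 0 ≤ (A * M' + A' * M) ^ 2 - 4 * (A * A') * (M * M') := by
    have : (A * M' + A' * M) ^ 2 - 4 * (A * A') * (M * M') = (A * M' - A' * M) ^ 2 := by ring
    rw [this]; positivity
  have hDN : 0 ≤ M * M' + 4 * (A * M' + A' * M) - A * A' := by
    have : M * M' - A * A' = (M - A) * M' + A * (M' - A') := by ring
    have h1 : 0 ≤ (M - A) * M' + A * (M' - A') := add_nonneg (mul_nonneg hP0 hM'.le) (mul_nonneg hA0 hP0')
    linarith [this, h1, hS0]
  have t1 : 0 ≤ (A * M' + A' * M) * (2 * (M * M') - (A * M' + A' * M))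
      * (6 * (A * M' + A' * M) ^ 2 - (A * M' + A' * M) * (M * M') + 2 * (M * M') ^ 2) :=
    mul_nonneg (mul_nonneg hS0 h2DS) hquad
  have t2 : 0 ≤ 3 * (A * M' + A' * M) * (M * M' + 2 * (A * M' + A' * M))
      * ((A * M' + A' * M) ^ 2 - 4 * (A * A') * (M * M')) :=
    mul_nonneg (mul_nonneg (mul_nonneg (by norm_num) hS0) (by positivity)) hsq
  have t3 : 0 ≤ 4 * (A * A') ^ 2 * (M * M' + 4 * (A * M' + A' * M) - A * A') * (M * M') :=
    mul_nonneg (mul_nonneg (mul_nonneg (by norm_num) (sq_nonneg _)) hDN) hD0.le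
  have hcert : 0 ≤ (A * A') * ((A * M' + A' * M) * (2 * (M * M') - (A * M' + A' * M))
      * (6 * (A * M' + A' * M) ^ 2 - (A * M' + A' * M) * (M * M') + 2 * (M * M') ^ 2)
      + 3 * (A * M' + A' * M) * (M * M' + 2 * (A * M' + A' * M))
      * ((A * M' + A' * M) ^ 2 - 4 * (A * A') * (M * M'))
      + 4 * (A * A') ^ 2 * (M * M' + 4 * (A * M' + A' * M) - A * A') * (M * M')) :=
    mul_nonneg hN0 (add_nonneg (add_nonneg t1 t2) t3)
  -- Δ ≥ 0
  have key : 4 * (M * M') * (A * (4 * M ^ 3 + 2 * A * M ^ 2 + A ^ 2 * M + A ^ 3) * M' ^ 4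
      + A' * (4 * M' ^ 3 + 2 * A' * M' ^ 2 + A' ^ 2 * M' + A' ^ 3) * M ^ 4
      - (A * M' + A' * M - A * A') * (4 * (M * M') ^ 3 + 2 * (A * M' + A' * M - A * A') * (M * M') ^ 2
          + (A * M' + A' * M - A * A') ^ 2 * (M * M') + (A * M' + A' * M - A * A') ^ 3))
      = (A * A') * ((A * M' + A' * M) * (2 * (M * M') - (A * M' + A' * M))
      * (6 * (A * M' + A' * M) ^ 2 - (A * M' + A' * M) * (M * M') + 2 * (M * M') ^ 2)
      + 3 * (A * M' + A' * M) * (M * M' + 2 * (A * M' + A' * M))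
      * ((A * M' + A' * M) ^ 2 - 4 * (A * A') * (M * M'))
      + 4 * (A * A') ^ 2 * (M * M' + 4 * (A * M' + A' * M) - A * A') * (M * M')) := by ring
  have hΔ : 0 ≤ A * (4 * M ^ 3 + 2 * A * M ^ 2 + A ^ 2 * M + A ^ 3) * M' ^ 4
      + A' * (4 * M' ^ 3 + 2 * A' * M' ^ 2 + A' ^ 2 * M' + A' ^ 3) * M ^ 4
      - (A * M' + A' * M - A * A') * (4 * (M * M') ^ 3 + 2 * (A * M' + A' * M - A * A') * (M * M') ^ 2
          + (A * M' + A' * M - A * A') ^ 2 * (M * M') + (A * M' + A' * M - A * A') ^ 3) := by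
    have h4D : 0 < 4 * (M * M') := by linarith
    exact nonneg_of_mul_nonneg_right (by rw [key]; exact hcert) h4D
  -- assemble
  have e1 := mul_le_mul_of_nonneg_left h (mul_nonneg hP0' (pow_nonneg hM'.le 4))
  have e2 := mul_le_mul_of_nonneg_left h' (mul_nonneg hP0 (pow_nonneg hM.le 4))
  have e3 := mul_nonneg (mul_nonneg hP0 hP0') hΔ
  linarith [e1, e2, e3]

/-- From Harris and BK′ to the third inequality: `F = 9a₁² − 3a₁a₂ + 2a₂c − 8cM ≥ 0`. -/
lemma third_alg (M A B C : ℤ) (hM : 0 < M) (hA0 : 0 ≤ A) (hAM : A ≤ M) (hCA : C ≤ A) (hH : C * M ≤ A ^ 2)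
    (hB : 4 * B * M ^ 4 ≤ A ^ 2 * (2 * M ^ 3 + A * M ^ 2 + A ^ 3)) :
    8 * C * M + 3 * A * B ≤ 9 * A ^ 2 + 2 * B * C := by
  have key : 4 * M ^ 5 * (9 * A ^ 2 - 3 * A * B + 2 * B * C - 8 * C * M)
      = (A ^ 2 * (2 * M ^ 3 + A * M ^ 2 + A ^ 3) - 4 * B * M ^ 4) * (3 * A - 2 * C) * M
        + (A ^ 2 - C * M) * (32 * M ^ 5 - 2 * A ^ 2 * (2 * M ^ 3 + A * M ^ 2 + A ^ 3))
        + A ^ 2 * (M - A) ^ 2 * (2 * A ^ 3 + A ^ 2 * M + 2 * A * M ^ 2 + 4 * M ^ 3) := by ring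
  have t1 : 0 ≤ (A ^ 2 * (2 * M ^ 3 + A * M ^ 2 + A ^ 3) - 4 * B * M ^ 4) * (3 * A - 2 * C) * M :=
    mul_nonneg (mul_nonneg (sub_nonneg.2 hB) (by linarith)) hM.le
  have hbound : A ^ 2 * (2 * M ^ 3 + A * M ^ 2 + A ^ 3) ≤ M ^ 2 * (4 * M ^ 3) := by
    have e1 : A ^ 2 ≤ M ^ 2 := pow_le_pow_left₀ hA0 hAM 2
    have e2 : 2 * M ^ 3 + A * M ^ 2 + A ^ 3 ≤ 4 * M ^ 3 := by
      have f1 : A * M ^ 2 ≤ M * M ^ 2 := mul_le_mul_of_nonneg_right hAM (sq_nonneg M)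
      have f2 : A ^ 3 ≤ M ^ 3 := pow_le_pow_left₀ hA0 hAM 3
      linarith [f1, f2]
    exact mul_le_mul e1 e2 (by positivity) (by positivity)
  have t2 : 0 ≤ (A ^ 2 - C * M) * (32 * M ^ 5 - 2 * A ^ 2 * (2 * M ^ 3 + A * M ^ 2 + A ^ 3)) :=
    mul_nonneg (sub_nonneg.2 hH) (by linarith [hbound, pow_nonneg hM.le 5])
  have t3 : 0 ≤ A ^ 2 * (M - A) ^ 2 * (2 * A ^ 3 + A ^ 2 * M + 2 * A * M ^ 2 + 4 * M ^ 3) := by positivity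
  have hF : 0 ≤ 9 * A ^ 2 - 3 * A * B + 2 * B * C - 8 * C * M := by
    have h4 : 0 < 4 * M ^ 5 := by positivity
    exact nonneg_of_mul_nonneg_right (by rw [key]; linarith [t1, t2, t3]) h4
  linarith

/-- The third inequality in the six-count form, from `F ≥ 0` and the count identities. -/
lemma third_count_alg (M A B C P Q Z X : ℤ) (hP : A + P = M) (hQ : Q + B = A) (hZ : C + P + P = M + Z)
    (hX : X + Z = P) (hF : 8 * C * M + 3 * A * B ≤ 9 * A ^ 2 + 2 * B * C) :
    (P + P + 2 * Z) * (2 * C) ≤ (Q + 2 * X) * (Q + 2 * X) + (Q + 2 * X) * B := by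
  have hX' : X = P - Z := by linarith
  have hZ' : Z = C + P + P - M := by linarith
  have hQ' : Q = A - B := by linarith
  have hP' : P = M - A := by linarith
  subst hX' hZ' hQ' hP'
  linarith [hF]

end Summit.Ventures.PercRepro2.Tail2D
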